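import Mathlib
import Literature.NumberTheory.LFunctions.Zhang2022.Section4GaussianWeight
import HarnessLib

/-!
# Zhang (2022), §16 (16.10): the remainder of Landau's contour is `O(𝓛⁻²⁰⁰⁰)` — pure bookkeeping

Topic `Literature/NumberTheory/LFunctions/Zhang2022` (Landau–Siegel audit tree; verdict-neutral).
Y. Zhang, *Discrete mean estimates and the Landau–Siegel zero*, arXiv:2211.02515v1 (2022)
[Zhang2022LandauSiegel] — **an unrefereed manuscript under adjudication**; nothing here asserts its
Theorems 1–2. This file is real arithmetic only: the explicit remainder produced by the contour engine
for (16.10) [Z22 p.92, tex L4550] at the parameters `H = 𝓛²⁰`, `Λ = 𝓛³⁰`, `η ≍ 1/𝓛`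
(`Eq1610.integral_u023_sub_residues_le_local`: tails, left segment, horizontal sides, and the residue
at the exceptional-zero pole) is bounded by `K_M·A·𝓛⁻²⁰⁰⁰` with an explicit constant `A` depending only
on the constants of the zero-free regions (`numeric_bound`). Inputs are the sizes of the pieces as
hypotheses (`P₄ ≤ e^{𝓛⁹}𝓛⁵¹⁹`, `d ≤ e^{𝓛⁹}`, `(d/P₄)^{η} ≤ e^{−18η𝓛^{1.1}}`, the Gaussian budget
`𝓛²⁶⁰⁰e^{2𝓛⁹+2}e^{−(H−1)²/(4Λ)} ≤ 1`, `𝓛²⁰²⁰ ≤ e^{(9c/4)𝓛^{1/10}}`, `1 − ρ̃ ≤ K𝓛⁻²⁰²²`, `bⱼ ≍ α = π𝓛⁻⁹`).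

## References

* Y. Zhang, arXiv:2211.02515v1 (2022), §16 (16.10) p.92; §8 proof of Lemma 8.2 p.44.
  [cite: Zhang2022LandauSiegel, §16 (16.10) p.92]
-/

noncomputable section

open Real

namespace Literature.NumberTheory.LFunctions.Zhang2022.Eq1610

/-- `√(4πL³⁰) ≤ 4L¹⁵` (`π ≤ 4`). [cite: Zhang2022LandauSiegel, §16 (16.10) p.92] -/
theorem sqrt_four_pi_pow_le {L : ℝ} (hL : 0 ≤ L) : Real.sqrt (4 * π * L ^ 30) ≤ 4 * L ^ 15 := by
  rw [Real.sqrt_le_left (by positivity)]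
  have : L ^ 30 = (L ^ 15) ^ 2 := by ring
  rw [this]
  nlinarith [Real.pi_lt_four, Real.pi_pos, pow_nonneg hL 15, sq_nonneg (L ^ 15)]

/-- The Gaussian pieces: from the budget `L²⁶⁰⁰e^{2L⁹+2}g ≤ 1`, `Lⁿe^{aL⁹}g ≤ L⁻²⁰⁰⁰` for
`n + 2000 ≤ 2600`, `a ≤ 2`. [cite: Zhang2022LandauSiegel, §16 (16.10) p.92] -/
theorem gauss_piece_le {L g : ℝ} (hL : 1 ≤ L) (hg0 : 0 ≤ g)
    (hgb : L ^ 2600 * Real.exp (2 * L ^ 9 + 2) * g ≤ 1) (n : ℕ) (a : ℝ) (hn : n + 2000 ≤ 2600)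
    (ha : a ≤ 2) : L ^ n * Real.exp (a * L ^ 9) * g ≤ (L ^ 2000)⁻¹ := by
  have hL0 : 0 < L := by linarith
  have hL2000 : 0 < L ^ 2000 := by positivity
  have h1 : L ^ n * L ^ 2000 ≤ L ^ 2600 := by
    rw [← pow_add]; exact pow_le_pow_right₀ hL hn
  have h2 : Real.exp (a * L ^ 9) ≤ Real.exp (2 * L ^ 9 + 2) := by
    refine Real.exp_le_exp.mpr ?_
    have := mul_le_mul_of_nonneg_right ha (pow_pos hL0 9).le
    linarith
  have hprod : L ^ n * Real.exp (a * L ^ 9) * g * L ^ 2000 ≤ 1 := by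
    calc L ^ n * Real.exp (a * L ^ 9) * g * L ^ 2000
        = (L ^ n * L ^ 2000) * Real.exp (a * L ^ 9) * g := by ring
      _ ≤ L ^ 2600 * Real.exp (2 * L ^ 9 + 2) * g := by gcongr
      _ ≤ 1 := hgb
  calc L ^ n * Real.exp (a * L ^ 9) * g
      = (L ^ n * Real.exp (a * L ^ 9) * g * L ^ 2000) / L ^ 2000 := by field_simp
    _ ≤ 1 / L ^ 2000 := div_le_div_of_nonneg_right hprod hL2000.le
    _ = (L ^ 2000)⁻¹ := one_div _

/-- **Tails** `(1/2π)·2·M₀·(Y-factor)·(gauss·√(4πΛ)/2) ≤ K_M(48/π)L⁻²⁰⁰⁰` at `M₀ = 8K_M`, `σ₀ = 1`,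
`P ≤ e^{L⁹}L⁵¹⁹`. [cite: Zhang2022LandauSiegel, §16 (16.10) p.92] -/
theorem tails_le {L KM P g : ℝ} (hL : 1 ≤ L) (hKM : 0 ≤ KM) (hP1 : 1 ≤ P)
    (hPle : P ≤ Real.exp (L ^ 9) * L ^ 519) (hg0 : 0 ≤ g)
    (hgb : L ^ 2600 * Real.exp (2 * L ^ 9 + 2) * g ≤ 1) :
    1 / (2 * π) * (2 * (8 * KM * (P ^ (1 : ℝ) * rexp ((1 : ℝ) ^ 2 / (4 * L ^ 30)) / |(1 : ℝ)|) *
      (g * (Real.sqrt (4 * π * L ^ 30) / 2)))) ≤ KM * (48 / π) * (L ^ 2000)⁻¹ := by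
  have hL0 : 0 < L := by linarith
  have hπ := Real.pi_pos
  rw [Real.rpow_one, abs_one, div_one]
  have hP0 : 0 ≤ P := by linarith
  have hsqrt := sqrt_four_pi_pow_le hL0.le
  have hexp1 : rexp ((1 : ℝ) ^ 2 / (4 * L ^ 30)) ≤ 3 := by
    refine (Real.exp_le_exp.mpr ?_).trans (by have := Real.exp_one_lt_d9; linarith)
    rw [one_pow, div_le_one (by positivity)]
    have : 1 ≤ L ^ 30 := one_le_pow₀ hL
    linarith
  have hcore : P * g * L ^ 15 ≤ (L ^ 2000)⁻¹ := by
    have h := gauss_piece_le hL hg0 hgb 534 1 (by norm_num) (by norm_num)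
    calc P * g * L ^ 15 ≤ (Real.exp (L ^ 9) * L ^ 519) * g * L ^ 15 := by gcongr
      _ = L ^ 534 * Real.exp (1 * L ^ 9) * g := by rw [one_mul]; ring
      _ ≤ (L ^ 2000)⁻¹ := h
  calc 1 / (2 * π) * (2 * (8 * KM * (P * rexp ((1 : ℝ) ^ 2 / (4 * L ^ 30))) *
        (g * (Real.sqrt (4 * π * L ^ 30) / 2))))
      ≤ 1 / (2 * π) * (2 * (8 * KM * (P * 3) * (g * (4 * L ^ 15 / 2)))) := by gcongr
    _ = KM * (48 / π) * (P * g * L ^ 15) := by field_simp; ring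
    _ ≤ KM * (48 / π) * (L ^ 2000)⁻¹ := by gcongr

/-- **Left segment** `(1/2π)·M₁·(Y-factor at −η)·√(4πΛ) ≤ K_M·A₂·L⁻²⁰⁰⁰` at
`M₁ = (η⁻¹ + B_ζ)K_M B_ζ M_inv(1 + 2/η)d^{η}`: the saving is `(d/P₄)^{η} ≤ e^{−18ηL^{1.1}} ≤ e^{−(9c/4)L^{1/10}}`
against `L²⁰²⁰ ≤ e^{(9c/4)L^{1/10}}`. [cite: Zhang2022LandauSiegel, §16 (16.10) p.92] -/
theorem left_le {L η Bζ Minv KM P dd cL CL Cζ : ℝ} (hL : 1 ≤ L) (hη0 : 0 < η) (hη1 : η ≤ 1)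
    (hηlow : cL / (8 * L) ≤ η) (hcL : 0 < cL) (hBζ0 : 0 ≤ Bζ) (hBζL : Bζ ≤ Cζ * L)
    (hCζ : 0 < Cζ) (hMinv0 : 0 < Minv) (hMinvL : Minv ≤ 2 * (CL + 1) * L) (hCL : 0 ≤ CL)
    (hKM : 0 ≤ KM) (hP1 : 1 ≤ P) (hdd1 : 1 ≤ dd)
    (hdP : (dd / P) ^ η ≤ Real.exp (-(18 * η * L ^ (1.1 : ℝ))))
    (hG : L ^ (2020 : ℝ) ≤ Real.exp (9 * cL / 4 * L ^ (1 / 10 : ℝ))) :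
    1 / (2 * π) * ((η⁻¹ + Bζ) * KM * Bζ * (Minv * (1 + 2 / η)) * dd ^ η *
      (P ^ (-η) * rexp ((-η) ^ 2 / (4 * L ^ 30)) / |(-η)|) * Real.sqrt (4 * π * L ^ 30)) ≤
      KM * (1 / (2 * π) * ((8 / cL + Cζ) * Cζ * (2 * (CL + 1)) * (1 + 16 / cL) * (24 / cL) * 4)) *
        (L ^ 2000)⁻¹ := by
  have hL0 : 0 < L := by linarith
  have hπ := Real.pi_pos
  have hP0 : 0 < P := by linarith
  have hdd0 : 0 ≤ dd := by linarith
  have hsqrt := sqrt_four_pi_pow_le hL0.le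
  have hexpη : rexp ((-η) ^ 2 / (4 * L ^ 30)) ≤ 3 := by
    refine (Real.exp_le_exp.mpr ?_).trans (by have := Real.exp_one_lt_d9; linarith)
    rw [div_le_one (by positivity)]
    have h1 : (-η) ^ 2 ≤ 1 := by
      rw [neg_sq, sq]
      calc η * η ≤ 1 * 1 := mul_le_mul hη1 hη1 hη0.le zero_le_one
        _ = 1 := one_mul 1
    have : 1 ≤ L ^ 30 := one_le_pow₀ hL
    linarith
  -- `η⁻¹ ≤ 8L/c`
  have hηinv : η⁻¹ ≤ 8 * L / cL := by
    have h8 : 0 < cL / (8 * L) := by positivity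
    calc η⁻¹ ≤ (cL / (8 * L))⁻¹ := inv_anti₀ h8 hηlow
      _ = 8 * L / cL := by rw [inv_div]
  -- the decay
  set X : ℝ := 9 * cL / 4 * L ^ (1 / 10 : ℝ) with hX
  have hdecay : (dd / P) ^ η ≤ Real.exp (-X) := by
    refine hdP.trans (Real.exp_le_exp.mpr ?_)
    have h11 : L ^ (1.1 : ℝ) = L * L ^ (1 / 10 : ℝ) := by
      rw [show (1.1 : ℝ) = 1 + 1 / 10 by norm_num, Real.rpow_add hL0, Real.rpow_one]
    rw [h11, neg_le_neg_iff, hX]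
    have hpow0 : 0 ≤ L ^ (1 / 10 : ℝ) := Real.rpow_nonneg hL0.le _
    have h1 : cL / (8 * L) * (L * L ^ (1 / 10 : ℝ)) ≤ η * (L * L ^ (1 / 10 : ℝ)) :=
      mul_le_mul_of_nonneg_right hηlow (by positivity)
    have h2 : cL / (8 * L) * (L * L ^ (1 / 10 : ℝ)) = cL / 8 * L ^ (1 / 10 : ℝ) := by
      field_simp
    calc 9 * cL / 4 * L ^ (1 / 10 : ℝ) = 18 * (cL / 8 * L ^ (1 / 10 : ℝ)) := by ring
      _ ≤ 18 * (η * (L * L ^ (1 / 10 : ℝ))) := by rw [← h2]; linarith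
      _ = 18 * η * (L * L ^ (1 / 10 : ℝ)) := by ring
  have hL20 : L ^ 20 * Real.exp (-X) ≤ (L ^ 2000)⁻¹ := by
    have h2020 : L ^ (2020 : ℝ) = L ^ 20 * L ^ 2000 := by norm_cast; ring
    rw [h2020] at hG
    have hexp0 : 0 < Real.exp X := Real.exp_pos _
    calc L ^ 20 * Real.exp (-X) = (L ^ 20 * L ^ 2000) / Real.exp X / L ^ 2000 := by
          rw [Real.exp_neg]; field_simp
      _ ≤ Real.exp X / Real.exp X / L ^ 2000 := by gcongr
      _ = (L ^ 2000)⁻¹ := by rw [div_self hexp0.ne', one_div]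
  -- the bracket `d^η (P^{-η} e₃ / η) ≤ e^{-X}·3·(8L/c)`
  have hratio : dd ^ η * P ^ (-η) = (dd / P) ^ η := by
    rw [Real.div_rpow hdd0 hP0.le, Real.rpow_neg hP0.le, div_eq_mul_inv]
  have habsη : |(-η)| = η := by rw [abs_neg, abs_of_pos hη0]
  have hbr : dd ^ η * (P ^ (-η) * rexp ((-η) ^ 2 / (4 * L ^ 30)) / |(-η)|) ≤
      Real.exp (-X) * 3 * (8 * L / cL) := by
    rw [habsη]
    have hrw : dd ^ η * (P ^ (-η) * rexp ((-η) ^ 2 / (4 * L ^ 30)) / η) =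
        (dd ^ η * P ^ (-η)) * rexp ((-η) ^ 2 / (4 * L ^ 30)) * η⁻¹ := by
      rw [div_eq_mul_inv]; ring
    rw [hrw, hratio]
    have h0 : 0 ≤ (dd / P) ^ η := Real.rpow_nonneg (div_nonneg hdd0 hP0.le) _
    have hexp0 : 0 ≤ Real.exp (-X) := (Real.exp_pos _).le
    exact mul_le_mul (mul_le_mul hdecay hexpη (Real.exp_pos _).le hexp0) hηinv
      (inv_pos.mpr hη0).le (by positivity)
  -- the other factors
  have hf1 : η⁻¹ + Bζ ≤ (8 / cL + Cζ) * L := by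
    have h1 : 8 * L / cL = 8 / cL * L := by ring
    have h2 : (8 / cL + Cζ) * L = 8 / cL * L + Cζ * L := by ring
    rw [h1] at hηinv; rw [h2]; linarith
  have hf2 : 1 + 2 / η ≤ (1 + 16 / cL) * L := by
    have h2η : 2 / η ≤ 16 * L / cL := by
      rw [div_eq_mul_inv]
      calc 2 * η⁻¹ ≤ 2 * (8 * L / cL) := by linarith
        _ = 16 * L / cL := by ring
    have : (1 + 16 / cL) * L = L + 16 * L / cL := by ring
    rw [this]; linarith
  have hf0 : 0 ≤ η⁻¹ + Bζ := by positivity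
  have hbr0 : 0 ≤ dd ^ η * (P ^ (-η) * rexp ((-η) ^ 2 / (4 * L ^ 30)) / |(-η)|) := by
    rw [habsη]; positivity
  have hsqrt0 : 0 ≤ Real.sqrt (4 * π * L ^ 30) := Real.sqrt_nonneg _
  calc 1 / (2 * π) * ((η⁻¹ + Bζ) * KM * Bζ * (Minv * (1 + 2 / η)) * dd ^ η *
        (P ^ (-η) * rexp ((-η) ^ 2 / (4 * L ^ 30)) / |(-η)|) * Real.sqrt (4 * π * L ^ 30))
      = 1 / (2 * π) * ((η⁻¹ + Bζ) * KM * Bζ * (Minv * (1 + 2 / η)) *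
          (dd ^ η * (P ^ (-η) * rexp ((-η) ^ 2 / (4 * L ^ 30)) / |(-η)|)) *
          Real.sqrt (4 * π * L ^ 30)) := by ring
    _ ≤ 1 / (2 * π) * (((8 / cL + Cζ) * L) * KM * (Cζ * L) * ((2 * (CL + 1) * L) *
          ((1 + 16 / cL) * L)) * (Real.exp (-X) * 3 * (8 * L / cL)) * (4 * L ^ 15)) := by
        gcongr 1 / (2 * π) * (?_ * KM * ?_ * (?_ * ?_) * ?_ * ?_)
    _ = KM * (1 / (2 * π) * ((8 / cL + Cζ) * Cζ * (2 * (CL + 1)) * (1 + 16 / cL) * (24 / cL) * 4)) *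
          (L ^ 20 * Real.exp (-X)) := by
        field_simp; ring
    _ ≤ KM * (1 / (2 * π) * ((8 / cL + Cζ) * Cζ * (2 * (CL + 1)) * (1 + 16 / cL) * (24 / cL) * 4)) *
          (L ^ 2000)⁻¹ := by gcongr

/-- **Horizontal sides** `(1/2π)·2·(σ₀ − a)·M₂·(…) ≤ K_M·A₃·L⁻²⁰⁰⁰` at
`M₂ = (1 + B_ζ)K_M B_ζ·3M_inv·d`, `d ≤ e^{L⁹}`, `P ≤ e^{L⁹}L⁵¹⁹`.
[cite: Zhang2022LandauSiegel, §16 (16.10) p.92] -/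
theorem horiz_le {L η H Bζ Minv KM P dd g b2 CL Cζ : ℝ} (hL : 64 ≤ L) (hη0 : 0 < η) (hη1 : η ≤ 1)
    (hH : H = L ^ 20) (hBζ0 : 0 ≤ Bζ) (hBζL : Bζ ≤ Cζ * L) (hCζ : 0 < Cζ) (hMinv0 : 0 < Minv)
    (hMinvL : Minv ≤ 2 * (CL + 1) * L) (hCL : 0 ≤ CL) (hKM : 0 ≤ KM) (hb2 : 0 < b2)
    (hb2u : b2 < 1) (hP1 : 1 ≤ P) (hPle : P ≤ Real.exp (L ^ 9) * L ^ 519) (hdd1 : 1 ≤ dd)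
    (hddle : dd ≤ Real.exp (L ^ 9)) (hg0 : 0 ≤ g)
    (hgb : L ^ 2600 * Real.exp (2 * L ^ 9 + 2) * g ≤ 1) :
    1 / (2 * π) * (2 * ((1 - -η) * ((1 + Bζ) * KM * Bζ * (Minv * 3) * dd ^ (1 : ℝ) *
      (max (P ^ (-η)) (P ^ (1 : ℝ)) * rexp (max ((-η) ^ 2) ((1 : ℝ) ^ 2) / (4 * L ^ 30)) *
        g / (H - |b2|))))) ≤ KM * (36 * (1 + Cζ) * Cζ * (CL + 1) / π) * (L ^ 2000)⁻¹ := by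
  have hL1 : 1 ≤ L := by linarith
  have hL0 : 0 < L := by linarith
  have hπ := Real.pi_pos
  have hP0 : 0 < P := by linarith
  have hdd0 : 0 ≤ dd := by linarith
  rw [Real.rpow_one, Real.rpow_one]
  have hmax : max (P ^ (-η)) P ≤ P :=
    max_le ((Real.rpow_le_one_of_one_le_of_nonpos hP1 (by linarith)).trans hP1) le_rfl
  have hmax0 : 0 ≤ max (P ^ (-η)) P := le_trans hP0.le (le_max_right _ _)
  have hHb : 1 ≤ H - |b2| := by
    rw [hH, abs_of_pos hb2]
    have : (64 : ℝ) ≤ L ^ 20 := le_trans hL (le_self_pow₀ hL1 (by norm_num))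
    linarith
  have hexpmax : rexp (max ((-η) ^ 2) ((1 : ℝ) ^ 2) / (4 * L ^ 30)) ≤ 3 := by
    refine (Real.exp_le_exp.mpr ?_).trans (by have := Real.exp_one_lt_d9; linarith)
    rw [div_le_one (by positivity)]
    have h1 : (-η) ^ 2 ≤ 1 := by
      rw [neg_sq, sq]
      calc η * η ≤ 1 * 1 := mul_le_mul hη1 hη1 hη0.le zero_le_one
        _ = 1 := one_mul 1
    have : max ((-η) ^ 2) ((1 : ℝ) ^ 2) ≤ 1 := max_le h1 (by norm_num)
    have : 1 ≤ L ^ 30 := one_le_pow₀ hL1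
    linarith
  have hinner : max (P ^ (-η)) P * rexp (max ((-η) ^ 2) ((1 : ℝ) ^ 2) / (4 * L ^ 30)) * g /
      (H - |b2|) ≤ (Real.exp (L ^ 9) * L ^ 519) * 3 * g := by
    have hnum0 : 0 ≤ max (P ^ (-η)) P * rexp (max ((-η) ^ 2) ((1 : ℝ) ^ 2) / (4 * L ^ 30)) * g := by
      positivity
    calc _ ≤ max (P ^ (-η)) P * rexp (max ((-η) ^ 2) ((1 : ℝ) ^ 2) / (4 * L ^ 30)) * g :=
          div_le_self hnum0 hHb
      _ ≤ P * 3 * g := by gcongr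
      _ ≤ (Real.exp (L ^ 9) * L ^ 519) * 3 * g := by gcongr
  have hf1 : 1 - -η ≤ 2 := by linarith
  have hf2 : 1 + Bζ ≤ (1 + Cζ) * L := by
    have : (1 + Cζ) * L = L + Cζ * L := by ring
    rw [this]; linarith
  have hM3 : Minv * 3 ≤ 2 * (CL + 1) * L * 3 := by linarith
  have hcore : L ^ 522 * Real.exp (2 * L ^ 9) * g ≤ (L ^ 2000)⁻¹ :=
    gauss_piece_le hL1 hg0 hgb 522 2 (by norm_num) (le_refl 2)
  have hin0 : 0 ≤ max (P ^ (-η)) P * rexp (max ((-η) ^ 2) ((1 : ℝ) ^ 2) / (4 * L ^ 30)) * g /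
      (H - |b2|) := div_nonneg (by positivity) (by linarith)
  calc 1 / (2 * π) * (2 * ((1 - -η) * ((1 + Bζ) * KM * Bζ * (Minv * 3) * dd *
        (max (P ^ (-η)) P * rexp (max ((-η) ^ 2) ((1 : ℝ) ^ 2) / (4 * L ^ 30)) * g / (H - |b2|)))))
      ≤ 1 / (2 * π) * (2 * (2 * (((1 + Cζ) * L) * KM * (Cζ * L) * (2 * (CL + 1) * L * 3) *
          Real.exp (L ^ 9) * ((Real.exp (L ^ 9) * L ^ 519) * 3 * g)))) := by
        gcongr 1 / (2 * π) * (2 * (?_ * (?_ * KM * ?_ * ?_ * ?_ * ?_)))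
    _ = KM * (36 * (1 + Cζ) * Cζ * (CL + 1) / π) * (L ^ 522 * Real.exp (2 * L ^ 9) * g) := by
        have : Real.exp (2 * L ^ 9) = Real.exp (L ^ 9) * Real.exp (L ^ 9) := by
          rw [← Real.exp_add]; ring_nf
        rw [this]; field_simp; ring
    _ ≤ KM * (36 * (1 + Cζ) * Cζ * (CL + 1) / π) * (L ^ 2000)⁻¹ := by gcongr

/-- **The residue at the exceptional-zero pole** `M_inv(b₁⁻¹ + B_ζ)K_M·2(1−ρ̃)·e·(e/b₂) ≤ K_M·A₄·L⁻²⁰⁰⁰`: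
`1 − ρ̃ ≤ KL⁻²⁰²²` against `b₁⁻¹, b₂⁻¹ = O(L⁹)`, `M_inv, B_ζ = O(L)` — polynomially, NOT exponentially
small. [cite: Zhang2022LandauSiegel, §15 (15.15) p.85] -/
theorem exc_le {L Bζ Minv KM ρ b1 b2 CL Cζ K₅ : ℝ} (hL : 1 ≤ L) (hBζ0 : 0 ≤ Bζ)
    (hBζL : Bζ ≤ Cζ * L) (hCζ : 0 < Cζ) (hMinvL : Minv ≤ 2 * (CL + 1) * L)
    (hCL : 0 ≤ CL) (hKM : 0 ≤ KM) (hρ1 : ρ < 1) (hρK : 1 - ρ ≤ K₅ * (L ^ 2022)⁻¹) (hK₅ : 0 < K₅)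
    (hb1l : π / L ^ 9 / 2 ≤ b1) (hb2l : π / L ^ 9 ≤ b2) :
    Minv * (b1⁻¹ + Bζ) * KM * (2 * (1 - ρ)) * Real.exp 1 * (Real.exp 1 / b2) ≤
      KM * (2 * (CL + 1) * (2 / π + Cζ) * (2 * K₅) * 3 * (3 / π)) * (L ^ 2000)⁻¹ := by
  have hL0 : 0 < L := by linarith
  have hπ := Real.pi_pos
  have he3 : Real.exp 1 ≤ 3 := by have := Real.exp_one_lt_d9; linarith
  have hL9 : 0 < L ^ 9 := by positivity
  have hα0 : 0 < π / L ^ 9 := by positivity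
  have hb1 : 0 < b1 := by linarith [half_pos hα0]
  have hb2 : 0 < b2 := by linarith
  have hb1inv : b1⁻¹ ≤ 2 / π * L ^ 9 := by
    calc b1⁻¹ ≤ (π / L ^ 9 / 2)⁻¹ := inv_anti₀ (by positivity) hb1l
      _ = 2 / π * L ^ 9 := by field_simp
  have hLL9 : L ≤ L ^ 9 := le_self_pow₀ hL (by norm_num)
  have hf1 : b1⁻¹ + Bζ ≤ (2 / π + Cζ) * L ^ 9 := by
    have h1 : Bζ ≤ Cζ * L ^ 9 := hBζL.trans (mul_le_mul_of_nonneg_left hLL9 hCζ.le)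
    have h2 : (2 / π + Cζ) * L ^ 9 = 2 / π * L ^ 9 + Cζ * L ^ 9 := by ring
    rw [h2]; linarith
  have hf2 : Real.exp 1 / b2 ≤ 3 / π * L ^ 9 := by
    calc Real.exp 1 / b2 ≤ 3 / b2 := div_le_div_of_nonneg_right he3 hb2.le
      _ ≤ 3 / (π / L ^ 9) := div_le_div_of_nonneg_left (by norm_num) hα0 hb2l
      _ = 3 / π * L ^ 9 := by field_simp
  have hρ0 : 0 ≤ 1 - ρ := by linarith
  have hf0 : 0 ≤ b1⁻¹ + Bζ := by positivity
  have htail : L ^ 19 * (L ^ 2022)⁻¹ ≤ (L ^ 2000)⁻¹ := by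
    have hpow : L ^ 2022 = L ^ 19 * (L ^ 3 * L ^ 2000) := by ring
    rw [hpow, mul_inv, ← mul_assoc, mul_inv_cancel₀ (pow_ne_zero 19 hL0.ne'), one_mul, mul_inv]
    have h3 : 1 ≤ L ^ 3 := one_le_pow₀ hL
    calc (L ^ 3)⁻¹ * (L ^ 2000)⁻¹ ≤ 1 * (L ^ 2000)⁻¹ := by
          gcongr; exact inv_le_one_of_one_le₀ h3
      _ = (L ^ 2000)⁻¹ := one_mul _
  calc Minv * (b1⁻¹ + Bζ) * KM * (2 * (1 - ρ)) * Real.exp 1 * (Real.exp 1 / b2)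
      ≤ (2 * (CL + 1) * L) * ((2 / π + Cζ) * L ^ 9) * KM * (2 * (K₅ * (L ^ 2022)⁻¹)) * 3 *
          (3 / π * L ^ 9) := by
        gcongr ?_ * ?_ * KM * (2 * ?_) * ?_ * ?_
    _ = KM * (2 * (CL + 1) * (2 / π + Cζ) * (2 * K₅) * 3 * (3 / π)) * (L ^ 19 * (L ^ 2022)⁻¹) := by
        ring
    _ ≤ KM * (2 * (CL + 1) * (2 / π + Cζ) * (2 * K₅) * 3 * (3 / π)) * (L ^ 2000)⁻¹ := by gcongr

/-- **The remainder of (16.10) is `O(𝓛⁻²⁰⁰⁰)`.** With `L = 𝓛 ≥ 64`, `H = L²⁰`, `0 < η ≤ 1`,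
`η ≥ c/(8L)`, `0 ≤ B_ζ ≤ C_ζL`, `0 < M_inv ≤ 2(C_L+1)L`, `K_M ≥ 0`, `1 ≤ P ≤ e^{L⁹}L⁵¹⁹`, `1 ≤ d ≤ e^{L⁹}`,
`(d/P)^{η} ≤ e^{−18ηL^{1.1}}`, `π/(2L⁹) ≤ b₁`, `π/L⁹ ≤ b₂ < 1`, `ρ < 1`, `1 − ρ ≤ K/L²⁰²²`, `g ≥ 0` with
`L²⁶⁰⁰e^{2L⁹+2}g ≤ 1`, and `L²⁰²⁰ ≤ e^{(9c/4)L^{1/10}}`: the explicit remainder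
`(1/2π)(E_tails + E_left + 2E_horiz) + R₃` of `Eq1610.integral_u023_sub_residues_le_local` is
`≤ K_M·A·L⁻²⁰⁰⁰`, `A = 48/π + A₂ + A₃ + A₄` explicit in `c, C_L, C_ζ, K`.
[cite: Zhang2022LandauSiegel, §16 (16.10) p.92] -/
theorem numeric_bound {L η H Bζ Minv KM ρ b1 b2 P dd g cL CL Cζ K₅ : ℝ} (hL : 64 ≤ L)
    (hη0 : 0 < η) (hη1 : η ≤ 1) (hηlow : cL / (8 * L) ≤ η) (hcL : 0 < cL) (hH : H = L ^ 20)
    (hBζ0 : 0 ≤ Bζ) (hBζL : Bζ ≤ Cζ * L) (hCζ : 0 < Cζ) (hMinv0 : 0 < Minv)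
    (hMinvL : Minv ≤ 2 * (CL + 1) * L) (hCL : 0 ≤ CL) (hKM : 0 ≤ KM) (hρ1 : ρ < 1)
    (hρK : 1 - ρ ≤ K₅ * (L ^ 2022)⁻¹) (hK₅ : 0 < K₅) (hb1l : π / L ^ 9 / 2 ≤ b1)
    (hb2l : π / L ^ 9 ≤ b2) (hb2u : b2 < 1) (hP1 : 1 ≤ P) (hPle : P ≤ Real.exp (L ^ 9) * L ^ 519)
    (hdd1 : 1 ≤ dd) (hddle : dd ≤ Real.exp (L ^ 9))
    (hdP : (dd / P) ^ η ≤ Real.exp (-(18 * η * L ^ (1.1 : ℝ)))) (hg0 : 0 ≤ g)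
    (hgb : L ^ 2600 * Real.exp (2 * L ^ 9 + 2) * g ≤ 1)
    (hG : L ^ (2020 : ℝ) ≤ Real.exp (9 * cL / 4 * L ^ (1 / 10 : ℝ))) :
    1 / (2 * π) *
        (2 * (8 * KM * (P ^ (1 : ℝ) * rexp ((1 : ℝ) ^ 2 / (4 * L ^ 30)) / |(1 : ℝ)|) *
            (g * (Real.sqrt (4 * π * L ^ 30) / 2))) +
          (η⁻¹ + Bζ) * KM * Bζ * (Minv * (1 + 2 / η)) * dd ^ η *
            (P ^ (-η) * rexp ((-η) ^ 2 / (4 * L ^ 30)) / |(-η)|) *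
            Real.sqrt (4 * π * L ^ 30) +
          2 * ((1 - -η) * ((1 + Bζ) * KM * Bζ * (Minv * 3) * dd ^ (1 : ℝ) *
            (max (P ^ (-η)) (P ^ (1 : ℝ)) * rexp (max ((-η) ^ 2) ((1 : ℝ) ^ 2) / (4 * L ^ 30)) *
              g / (H - |b2|))))) +
      Minv * (b1⁻¹ + Bζ) * KM * (2 * (1 - ρ)) * Real.exp 1 * (Real.exp 1 / b2) ≤
      KM * (48 / π +
        1 / (2 * π) * ((8 / cL + Cζ) * Cζ * (2 * (CL + 1)) * (1 + 16 / cL) * (24 / cL) * 4) +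
        36 * (1 + Cζ) * Cζ * (CL + 1) / π +
        2 * (CL + 1) * (2 / π + Cζ) * (2 * K₅) * 3 * (3 / π)) * (L ^ 2000)⁻¹ := by
  have hL1 : 1 ≤ L := by linarith
  have hL0 : 0 < L := by linarith
  have hα0 : 0 < π / L ^ 9 := by positivity
  have hb2 : 0 < b2 := by linarith
  have hT1 := tails_le hL1 hKM hP1 hPle hg0 hgb
  have hT2 := left_le hL1 hη0 hη1 hηlow hcL hBζ0 hBζL hCζ hMinv0 hMinvL hCL hKM hP1 hdd1 hdP hG
  have hT3 := horiz_le hL hη0 hη1 hH hBζ0 hBζL hCζ hMinv0 hMinvL hCL hKM hb2 hb2u hP1 hPle hdd1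
    hddle hg0 hgb
  have hT4 := exc_le hL1 hBζ0 hBζL hCζ hMinvL hCL hKM hρ1 hρK hK₅ hb1l hb2l
  rw [mul_add (1 / (2 * π)), mul_add (1 / (2 * π))]
  linarith only [hT1, hT2, hT3, hT4]

/-! ## The wide range `dl < 2PT⁻⁸` (the support of `b₁`): `d/P₄ ≤ 2T⁻⁶`, `d ≤ 2P` -/

/-- **Left segment, wide range**: as `left_le` with the decay `(d/P)^{η} ≤ 2e^{−6ηL^{1.1}}`
(`d/P₄ ≤ 2T⁻⁶`) against `L²⁰²⁰ ≤ e^{(3c/4)L^{1/10}}`. [cite: Zhang2022LandauSiegel, §16 (16.10) p.92] -/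
theorem left_le_wide {L η Bζ Minv KM P dd cL CL Cζ : ℝ} (hL : 1 ≤ L) (hη0 : 0 < η) (hη1 : η ≤ 1)
    (hηlow : cL / (8 * L) ≤ η) (hcL : 0 < cL) (hBζ0 : 0 ≤ Bζ) (hBζL : Bζ ≤ Cζ * L)
    (hCζ : 0 < Cζ) (hMinv0 : 0 < Minv) (hMinvL : Minv ≤ 2 * (CL + 1) * L) (hCL : 0 ≤ CL)
    (hKM : 0 ≤ KM) (hP1 : 1 ≤ P) (hdd1 : 1 ≤ dd)
    (hdP : (dd / P) ^ η ≤ 2 * Real.exp (-(6 * η * L ^ (1.1 : ℝ))))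
    (hG : L ^ (2020 : ℝ) ≤ Real.exp (3 * cL / 4 * L ^ (1 / 10 : ℝ))) :
    1 / (2 * π) * ((η⁻¹ + Bζ) * KM * Bζ * (Minv * (1 + 2 / η)) * dd ^ η *
      (P ^ (-η) * rexp ((-η) ^ 2 / (4 * L ^ 30)) / |(-η)|) * Real.sqrt (4 * π * L ^ 30)) ≤
      KM * (1 / (2 * π) * ((8 / cL + Cζ) * Cζ * (2 * (CL + 1)) * (1 + 16 / cL) * (24 / cL) * 8)) *
        (L ^ 2000)⁻¹ := by
  have hL0 : 0 < L := by linarith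
  have hπ := Real.pi_pos
  have hP0 : 0 < P := by linarith
  have hdd0 : 0 ≤ dd := by linarith
  have hsqrt := sqrt_four_pi_pow_le hL0.le
  have hexpη : rexp ((-η) ^ 2 / (4 * L ^ 30)) ≤ 3 := by
    refine (Real.exp_le_exp.mpr ?_).trans (by have := Real.exp_one_lt_d9; linarith)
    rw [div_le_one (by positivity)]
    have h1 : (-η) ^ 2 ≤ 1 := by
      rw [neg_sq, sq]
      calc η * η ≤ 1 * 1 := mul_le_mul hη1 hη1 hη0.le zero_le_one
        _ = 1 := one_mul 1
    have : 1 ≤ L ^ 30 := one_le_pow₀ hL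
    linarith
  have hηinv : η⁻¹ ≤ 8 * L / cL := by
    have h8 : 0 < cL / (8 * L) := by positivity
    calc η⁻¹ ≤ (cL / (8 * L))⁻¹ := inv_anti₀ h8 hηlow
      _ = 8 * L / cL := by rw [inv_div]
  set X : ℝ := 3 * cL / 4 * L ^ (1 / 10 : ℝ) with hX
  have hdecay : (dd / P) ^ η ≤ 2 * Real.exp (-X) := by
    refine hdP.trans (mul_le_mul_of_nonneg_left (Real.exp_le_exp.mpr ?_) (by norm_num))
    have h11 : L ^ (1.1 : ℝ) = L * L ^ (1 / 10 : ℝ) := by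
      rw [show (1.1 : ℝ) = 1 + 1 / 10 by norm_num, Real.rpow_add hL0, Real.rpow_one]
    rw [h11, neg_le_neg_iff, hX]
    have hpow0 : 0 ≤ L ^ (1 / 10 : ℝ) := Real.rpow_nonneg hL0.le _
    have h1 : cL / (8 * L) * (L * L ^ (1 / 10 : ℝ)) ≤ η * (L * L ^ (1 / 10 : ℝ)) :=
      mul_le_mul_of_nonneg_right hηlow (by positivity)
    have h2 : cL / (8 * L) * (L * L ^ (1 / 10 : ℝ)) = cL / 8 * L ^ (1 / 10 : ℝ) := by
      field_simp
    calc 3 * cL / 4 * L ^ (1 / 10 : ℝ) = 6 * (cL / 8 * L ^ (1 / 10 : ℝ)) := by ring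
      _ ≤ 6 * (η * (L * L ^ (1 / 10 : ℝ))) := by rw [← h2]; linarith
      _ = 6 * η * (L * L ^ (1 / 10 : ℝ)) := by ring
  have hL20 : L ^ 20 * Real.exp (-X) ≤ (L ^ 2000)⁻¹ := by
    have h2020 : L ^ (2020 : ℝ) = L ^ 20 * L ^ 2000 := by norm_cast; ring
    rw [h2020] at hG
    have hexp0 : 0 < Real.exp X := Real.exp_pos _
    calc L ^ 20 * Real.exp (-X) = (L ^ 20 * L ^ 2000) / Real.exp X / L ^ 2000 := by
          rw [Real.exp_neg]; field_simp
      _ ≤ Real.exp X / Real.exp X / L ^ 2000 := by gcongr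
      _ = (L ^ 2000)⁻¹ := by rw [div_self hexp0.ne', one_div]
  have hratio : dd ^ η * P ^ (-η) = (dd / P) ^ η := by
    rw [Real.div_rpow hdd0 hP0.le, Real.rpow_neg hP0.le, div_eq_mul_inv]
  have habsη : |(-η)| = η := by rw [abs_neg, abs_of_pos hη0]
  have hbr : dd ^ η * (P ^ (-η) * rexp ((-η) ^ 2 / (4 * L ^ 30)) / |(-η)|) ≤
      (2 * Real.exp (-X)) * 3 * (8 * L / cL) := by
    rw [habsη]
    have hrw : dd ^ η * (P ^ (-η) * rexp ((-η) ^ 2 / (4 * L ^ 30)) / η) =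
        (dd ^ η * P ^ (-η)) * rexp ((-η) ^ 2 / (4 * L ^ 30)) * η⁻¹ := by
      rw [div_eq_mul_inv]; ring
    rw [hrw, hratio]
    have h0 : 0 ≤ (dd / P) ^ η := Real.rpow_nonneg (div_nonneg hdd0 hP0.le) _
    have hexp0 : 0 ≤ 2 * Real.exp (-X) := by positivity
    exact mul_le_mul (mul_le_mul hdecay hexpη (Real.exp_pos _).le hexp0) hηinv
      (inv_pos.mpr hη0).le (by positivity)
  have hf1 : η⁻¹ + Bζ ≤ (8 / cL + Cζ) * L := by
    have h1 : 8 * L / cL = 8 / cL * L := by ring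
    have h2 : (8 / cL + Cζ) * L = 8 / cL * L + Cζ * L := by ring
    rw [h1] at hηinv; rw [h2]; linarith
  have hf2 : 1 + 2 / η ≤ (1 + 16 / cL) * L := by
    have h2η : 2 / η ≤ 16 * L / cL := by
      rw [div_eq_mul_inv]
      calc 2 * η⁻¹ ≤ 2 * (8 * L / cL) := by linarith
        _ = 16 * L / cL := by ring
    have : (1 + 16 / cL) * L = L + 16 * L / cL := by ring
    rw [this]; linarith
  have hf0 : 0 ≤ η⁻¹ + Bζ := by positivity
  have hbr0 : 0 ≤ dd ^ η * (P ^ (-η) * rexp ((-η) ^ 2 / (4 * L ^ 30)) / |(-η)|) := by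
    rw [habsη]; positivity
  have hsqrt0 : 0 ≤ Real.sqrt (4 * π * L ^ 30) := Real.sqrt_nonneg _
  calc 1 / (2 * π) * ((η⁻¹ + Bζ) * KM * Bζ * (Minv * (1 + 2 / η)) * dd ^ η *
        (P ^ (-η) * rexp ((-η) ^ 2 / (4 * L ^ 30)) / |(-η)|) * Real.sqrt (4 * π * L ^ 30))
      = 1 / (2 * π) * ((η⁻¹ + Bζ) * KM * Bζ * (Minv * (1 + 2 / η)) *
          (dd ^ η * (P ^ (-η) * rexp ((-η) ^ 2 / (4 * L ^ 30)) / |(-η)|)) *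
          Real.sqrt (4 * π * L ^ 30)) := by ring
    _ ≤ 1 / (2 * π) * (((8 / cL + Cζ) * L) * KM * (Cζ * L) * ((2 * (CL + 1) * L) *
          ((1 + 16 / cL) * L)) * ((2 * Real.exp (-X)) * 3 * (8 * L / cL)) * (4 * L ^ 15)) := by
        gcongr 1 / (2 * π) * (?_ * KM * ?_ * (?_ * ?_) * ?_ * ?_)
    _ = KM * (1 / (2 * π) * ((8 / cL + Cζ) * Cζ * (2 * (CL + 1)) * (1 + 16 / cL) * (24 / cL) * 8)) *
          (L ^ 20 * Real.exp (-X)) := by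
        field_simp; ring
    _ ≤ KM * (1 / (2 * π) * ((8 / cL + Cζ) * Cζ * (2 * (CL + 1)) * (1 + 16 / cL) * (24 / cL) * 8)) *
          (L ^ 2000)⁻¹ := by gcongr

/-- **Horizontal sides, wide range**: as `horiz_le` with `d ≤ 2e^{L⁹}`.
[cite: Zhang2022LandauSiegel, §16 (16.10) p.92] -/
theorem horiz_le_wide {L η H Bζ Minv KM P dd g b2 CL Cζ : ℝ} (hL : 64 ≤ L) (hη0 : 0 < η)
    (hη1 : η ≤ 1) (hH : H = L ^ 20) (hBζ0 : 0 ≤ Bζ) (hBζL : Bζ ≤ Cζ * L) (hCζ : 0 < Cζ)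
    (hMinv0 : 0 < Minv) (hMinvL : Minv ≤ 2 * (CL + 1) * L) (hCL : 0 ≤ CL) (hKM : 0 ≤ KM)
    (hb2 : 0 < b2) (hb2u : b2 < 1) (hP1 : 1 ≤ P) (hPle : P ≤ Real.exp (L ^ 9) * L ^ 519)
    (hdd1 : 1 ≤ dd) (hddle : dd ≤ 2 * Real.exp (L ^ 9)) (hg0 : 0 ≤ g)
    (hgb : L ^ 2600 * Real.exp (2 * L ^ 9 + 2) * g ≤ 1) :
    1 / (2 * π) * (2 * ((1 - -η) * ((1 + Bζ) * KM * Bζ * (Minv * 3) * dd ^ (1 : ℝ) *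
      (max (P ^ (-η)) (P ^ (1 : ℝ)) * rexp (max ((-η) ^ 2) ((1 : ℝ) ^ 2) / (4 * L ^ 30)) *
        g / (H - |b2|))))) ≤ KM * (72 * (1 + Cζ) * Cζ * (CL + 1) / π) * (L ^ 2000)⁻¹ := by
  have hL1 : 1 ≤ L := by linarith
  have hL0 : 0 < L := by linarith
  have hπ := Real.pi_pos
  have hP0 : 0 < P := by linarith
  have hdd0 : 0 ≤ dd := by linarith
  rw [Real.rpow_one, Real.rpow_one]
  have hmax : max (P ^ (-η)) P ≤ P :=
    max_le ((Real.rpow_le_one_of_one_le_of_nonpos hP1 (by linarith)).trans hP1) le_rfl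
  have hmax0 : 0 ≤ max (P ^ (-η)) P := le_trans hP0.le (le_max_right _ _)
  have hHb : 1 ≤ H - |b2| := by
    rw [hH, abs_of_pos hb2]
    have : (64 : ℝ) ≤ L ^ 20 := le_trans hL (le_self_pow₀ hL1 (by norm_num))
    linarith
  have hexpmax : rexp (max ((-η) ^ 2) ((1 : ℝ) ^ 2) / (4 * L ^ 30)) ≤ 3 := by
    refine (Real.exp_le_exp.mpr ?_).trans (by have := Real.exp_one_lt_d9; linarith)
    rw [div_le_one (by positivity)]
    have h1 : (-η) ^ 2 ≤ 1 := by
      rw [neg_sq, sq]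
      calc η * η ≤ 1 * 1 := mul_le_mul hη1 hη1 hη0.le zero_le_one
        _ = 1 := one_mul 1
    have : max ((-η) ^ 2) ((1 : ℝ) ^ 2) ≤ 1 := max_le h1 (by norm_num)
    have : 1 ≤ L ^ 30 := one_le_pow₀ hL1
    linarith
  have hinner : max (P ^ (-η)) P * rexp (max ((-η) ^ 2) ((1 : ℝ) ^ 2) / (4 * L ^ 30)) * g /
      (H - |b2|) ≤ (Real.exp (L ^ 9) * L ^ 519) * 3 * g := by
    have hnum0 : 0 ≤ max (P ^ (-η)) P * rexp (max ((-η) ^ 2) ((1 : ℝ) ^ 2) / (4 * L ^ 30)) * g := by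
      positivity
    calc _ ≤ max (P ^ (-η)) P * rexp (max ((-η) ^ 2) ((1 : ℝ) ^ 2) / (4 * L ^ 30)) * g :=
          div_le_self hnum0 hHb
      _ ≤ P * 3 * g := by gcongr
      _ ≤ (Real.exp (L ^ 9) * L ^ 519) * 3 * g := by gcongr
  have hf1 : 1 - -η ≤ 2 := by linarith
  have hf2 : 1 + Bζ ≤ (1 + Cζ) * L := by
    have : (1 + Cζ) * L = L + Cζ * L := by ring
    rw [this]; linarith
  have hM3 : Minv * 3 ≤ 2 * (CL + 1) * L * 3 := by linarith
  have hcore : L ^ 522 * Real.exp (2 * L ^ 9) * g ≤ (L ^ 2000)⁻¹ :=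
    gauss_piece_le hL1 hg0 hgb 522 2 (by norm_num) (le_refl 2)
  have hin0 : 0 ≤ max (P ^ (-η)) P * rexp (max ((-η) ^ 2) ((1 : ℝ) ^ 2) / (4 * L ^ 30)) * g /
      (H - |b2|) := div_nonneg (by positivity) (by linarith)
  calc 1 / (2 * π) * (2 * ((1 - -η) * ((1 + Bζ) * KM * Bζ * (Minv * 3) * dd *
        (max (P ^ (-η)) P * rexp (max ((-η) ^ 2) ((1 : ℝ) ^ 2) / (4 * L ^ 30)) * g / (H - |b2|)))))
      ≤ 1 / (2 * π) * (2 * (2 * (((1 + Cζ) * L) * KM * (Cζ * L) * (2 * (CL + 1) * L * 3) *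
          (2 * Real.exp (L ^ 9)) * ((Real.exp (L ^ 9) * L ^ 519) * 3 * g)))) := by
        gcongr 1 / (2 * π) * (2 * (?_ * (?_ * KM * ?_ * ?_ * ?_ * ?_)))
    _ = KM * (72 * (1 + Cζ) * Cζ * (CL + 1) / π) * (L ^ 522 * Real.exp (2 * L ^ 9) * g) := by
        have : Real.exp (2 * L ^ 9) = Real.exp (L ^ 9) * Real.exp (L ^ 9) := by
          rw [← Real.exp_add]; ring_nf
        rw [this]; field_simp; ring
    _ ≤ KM * (72 * (1 + Cζ) * Cζ * (CL + 1) / π) * (L ^ 2000)⁻¹ := by gcongr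

/-- **The remainder of (16.10) is `O(𝓛⁻²⁰⁰⁰)`, wide range** (`d/P₄ ≤ 2T⁻⁶`, `d ≤ 2P`): as
`numeric_bound` with `(d/P)^{η} ≤ 2e^{−6ηL^{1.1}}`, `d ≤ 2e^{L⁹}`, `L²⁰²⁰ ≤ e^{(3c/4)L^{1/10}}`.
[cite: Zhang2022LandauSiegel, §16 (16.10) p.92] -/
theorem numeric_bound_wide {L η H Bζ Minv KM ρ b1 b2 P dd g cL CL Cζ K₅ : ℝ} (hL : 64 ≤ L)
    (hη0 : 0 < η) (hη1 : η ≤ 1) (hηlow : cL / (8 * L) ≤ η) (hcL : 0 < cL) (hH : H = L ^ 20)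
    (hBζ0 : 0 ≤ Bζ) (hBζL : Bζ ≤ Cζ * L) (hCζ : 0 < Cζ) (hMinv0 : 0 < Minv)
    (hMinvL : Minv ≤ 2 * (CL + 1) * L) (hCL : 0 ≤ CL) (hKM : 0 ≤ KM) (hρ1 : ρ < 1)
    (hρK : 1 - ρ ≤ K₅ * (L ^ 2022)⁻¹) (hK₅ : 0 < K₅) (hb1l : π / L ^ 9 / 2 ≤ b1)
    (hb2l : π / L ^ 9 ≤ b2) (hb2u : b2 < 1) (hP1 : 1 ≤ P) (hPle : P ≤ Real.exp (L ^ 9) * L ^ 519)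
    (hdd1 : 1 ≤ dd) (hddle : dd ≤ 2 * Real.exp (L ^ 9))
    (hdP : (dd / P) ^ η ≤ 2 * Real.exp (-(6 * η * L ^ (1.1 : ℝ)))) (hg0 : 0 ≤ g)
    (hgb : L ^ 2600 * Real.exp (2 * L ^ 9 + 2) * g ≤ 1)
    (hG : L ^ (2020 : ℝ) ≤ Real.exp (3 * cL / 4 * L ^ (1 / 10 : ℝ))) :
    1 / (2 * π) *
        (2 * (8 * KM * (P ^ (1 : ℝ) * rexp ((1 : ℝ) ^ 2 / (4 * L ^ 30)) / |(1 : ℝ)|) *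
            (g * (Real.sqrt (4 * π * L ^ 30) / 2))) +
          (η⁻¹ + Bζ) * KM * Bζ * (Minv * (1 + 2 / η)) * dd ^ η *
            (P ^ (-η) * rexp ((-η) ^ 2 / (4 * L ^ 30)) / |(-η)|) *
            Real.sqrt (4 * π * L ^ 30) +
          2 * ((1 - -η) * ((1 + Bζ) * KM * Bζ * (Minv * 3) * dd ^ (1 : ℝ) *
            (max (P ^ (-η)) (P ^ (1 : ℝ)) * rexp (max ((-η) ^ 2) ((1 : ℝ) ^ 2) / (4 * L ^ 30)) *
              g / (H - |b2|))))) +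
      Minv * (b1⁻¹ + Bζ) * KM * (2 * (1 - ρ)) * Real.exp 1 * (Real.exp 1 / b2) ≤
      KM * (48 / π +
        1 / (2 * π) * ((8 / cL + Cζ) * Cζ * (2 * (CL + 1)) * (1 + 16 / cL) * (24 / cL) * 8) +
        72 * (1 + Cζ) * Cζ * (CL + 1) / π +
        2 * (CL + 1) * (2 / π + Cζ) * (2 * K₅) * 3 * (3 / π)) * (L ^ 2000)⁻¹ := by
  have hL1 : 1 ≤ L := by linarith
  have hL0 : 0 < L := by linarith
  have hα0 : 0 < π / L ^ 9 := by positivity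
  have hb2 : 0 < b2 := by linarith
  have hT1 := tails_le hL1 hKM hP1 hPle hg0 hgb
  have hT2 := left_le_wide hL1 hη0 hη1 hηlow hcL hBζ0 hBζL hCζ hMinv0 hMinvL hCL hKM hP1 hdd1 hdP
    hG
  have hT3 := horiz_le_wide hL hη0 hη1 hH hBζ0 hBζL hCζ hMinv0 hMinvL hCL hKM hb2 hb2u hP1 hPle
    hdd1 hddle hg0 hgb
  have hT4 := exc_le hL1 hBζ0 hBζL hCζ hMinvL hCL hKM hρ1 hρK hK₅ hb1l hb2l
  rw [mul_add (1 / (2 * π)), mul_add (1 / (2 * π))]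
  linarith only [hT1, hT2, hT3, hT4]

end Literature.NumberTheory.LFunctions.Zhang2022.Eq1610
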